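import Summits.BirchSwinnertonDyer.BirchSwinnertonDyer.Theorems.EisensteinPrimesTwoVariableWeierstrass
import Mathlib.RingTheory.Flat.Basic
import Mathlib.RingTheory.Localization.BaseChange
import HarnessLib

/-!
# Preliminaries for the descent lemma `Λ₂ = ℤ_p⟦S⟧⟦T⟧ → Λ = ℤ_p⟦T⟧`
# (helper file 4a for crux 2 `GoodLatticeBDPValue`, stmt-BirchSwinnertonDyer-19032, cell `bsd-eis` seat `bsd-eis-k5-c2`; RULING L13 prover half)

Two `ℤ_p`-linear-algebra inputs of the descent theorem `EisensteinPrimesTwoVariableDescent.descent`: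

* §1 `finite_baseChange_of_isTorsion`: for a finitely generated TORSION `Λ = ℤ_p⟦S⟧`-module `C`,
  `ℚ_p ⊗_{ℤ_p} C` is finite-dimensional (strip the `p`-power part `p^k` of an annihilator
  `b = p^k b'`; `p^k C` is killed by `b' ∉ (p)` hence finitely generated over `ℤ_p` by Weierstrass
  division — tree `finite_of_lengthAt_eq_zero`; and `ℚ_p ⊗ p^k C = ℚ_p ⊗ C`, tree
  `bijective_baseChange_of_pow_smul`).  Applied to the (pseudo-null, hence `ℤ_p⟦S⟧`-torsion)
  cokernel of the elementary embedding of the two-variable Selmer dual.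
* §2 `nonempty_quotient_smul_linearEquiv`: if `π₀ : A → ℤ_p` is a retraction of the structure map
  with kernel `(s)` and `E` is `A`-free of rank `n`, then `E/sE ≅ ℤ_p^n` as `ℤ_p`-modules.  Applied
  with `A = ℤ_p⟦S⟧`, `s = S`, `E = Π Λ₂/(g_i)` (free by Weierstrass, file `…Weierstrass`).

HONEST FRAMING: generic algebra; closes nothing by itself (ky MEMO-1 R2 (v) road, k5-ty SPEC §1).
References: Washington, *Introduction to Cyclotomic Fields* §13.2; Bourbaki AC VII §4.
-/

-- the summit namespace `Summit.BirchSwinnertonDyer.BirchSwinnertonDyer` repeats the problem name by design (D-0017)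
set_option linter.dupNamespace false
set_option autoImplicit false

noncomputable section

open scoped TensorProduct

open PowerSeries IsLocalRing Function Literature.NumberTheory.EllipticCurves

namespace Summit.BirchSwinnertonDyer.BirchSwinnertonDyer.Theorems.IwasawaTwoVariable

universe u v

/-! ## §1 `ℚ_p ⊗_{ℤ_p} C` is finite-dimensional for a finitely generated TORSION `ℤ_p⟦S⟧`-module `C` -/

section FiniteBaseChange

variable (p : ℕ) [Fact p.Prime]

/-- Every non-zero `b ∈ Λ = ℤ_p⟦S⟧` is `p^k · b'` with `b' ∉ (p)` (i.e. `μ(b') = 0`):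
`Λ` is a Noetherian domain and `p` is prime in it. [folklore] -/
theorem exists_eq_C_p_pow_mul_not_dvd {b : IwasawaAlgebra p} (hb : b ≠ 0) :
    ∃ (k : ℕ) (b' : IwasawaAlgebra p),
      ¬ (PowerSeries.C (p : ℤ_[p]) : IwasawaAlgebra p) ∣ b' ∧
        b = (PowerSeries.C (p : ℤ_[p]) : IwasawaAlgebra p) ^ k * b' := by
  have hprime : Prime (PowerSeries.C (p : ℤ_[p]) : IwasawaAlgebra p) := by
    rw [← Ideal.span_singleton_prime]
    · exact IwasawaAlgebra.isPrime_augIdealP_holds p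
    · intro h
      have := congrArg PowerSeries.constantCoeff h
      simp only [PowerSeries.constantCoeff_C, map_zero] at this
      exact (Fact.out : p.Prime).ne_zero (by exact_mod_cast this)
  obtain ⟨k, b', hb', rfl⟩ := WfDvdMonoid.max_power_factor hb hprime.irreducible
  exact ⟨k, b', hb', rfl⟩

/-- **`ℚ_p ⊗_{ℤ_p} C` is finite-dimensional for a finitely generated torsion `Λ = ℤ_p⟦S⟧`-module
`C`.**  If `b = p^k b'` (`b' ∉ (p)`) kills `C`, then `b'` kills `p^k C`, which is therefore finitely
generated over `ℤ_p` (Weierstrass division by `b'`, tree `finite_of_lengthAt_eq_zero`), and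
`ℚ_p ⊗ p^k C = ℚ_p ⊗ C` (`p` is invertible in `ℚ_p`, tree `bijective_baseChange_of_pow_smul`).
(Washington §13.2.) [folklore] -/
theorem finite_baseChange_of_isTorsion (C : Type*) [AddCommGroup C]
    [Module (IwasawaAlgebra p) C] [Module ℤ_[p] C] [IsScalarTower ℤ_[p] (IwasawaAlgebra p) C]
    [Module.Finite (IwasawaAlgebra p) C] (hC : Module.IsTorsion (IwasawaAlgebra p) C) :
    Module.Finite ℚ_[p] (ℚ_[p] ⊗[ℤ_[p]] C) := by
  classical
  obtain ⟨b, hbann, hb0⟩ := Submodule.annihilator_top_inter_nonZeroDivisors hC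
  obtain ⟨k, b', hb', hbeq⟩ := exists_eq_C_p_pow_mul_not_dvd p (nonZeroDivisors.ne_zero hb0)
  -- `N = p^k C`, a `Λ`-submodule killed by `b'`
  set ψ : C →ₗ[IwasawaAlgebra p] C :=
    (PowerSeries.C (p : ℤ_[p]) : IwasawaAlgebra p) ^ k • LinearMap.id with hψ
  set N : Submodule (IwasawaAlgebra p) C := LinearMap.range ψ with hN
  have hNb' : Module.IsTorsionBy (IwasawaAlgebra p) N b' := by
    rintro ⟨x, hx⟩
    obtain ⟨c, rfl⟩ := LinearMap.mem_range.1 hx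
    ext
    simp only [SetLike.val_smul, ZeroMemClass.coe_zero, hψ, LinearMap.smul_apply, LinearMap.id_apply,
      ← mul_smul, mul_comm b', ← hbeq]
    exact Submodule.mem_annihilator.1 hbann c Submodule.mem_top
  -- hence `N` is finitely generated over `ℤ_p`
  let 𝔭 : PrimeSpectrum (IwasawaAlgebra p) :=
    ⟨IwasawaAlgebra.augIdealP p, IwasawaAlgebra.isPrime_augIdealP_holds p⟩
  have hlen : Module.lengthAt (IwasawaAlgebra p) N 𝔭 = 0 := by
    refine Module.lengthAt_eq_zero_of_isTorsionBy hNb' 𝔭 ?_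
    change b' ∉ IwasawaAlgebra.augIdealP p
    rw [IwasawaAlgebra.augIdealP, Ideal.mem_span_singleton]
    exact hb'
  haveI : Module.Finite ℤ_[p] N := finite_of_lengthAt_eq_zero p N 𝔭 rfl hlen
  -- and `ℚ_p ⊗ N ≅ ℚ_p ⊗ C`
  haveI : Module.Flat ℤ_[p] ℚ_[p] := IsLocalization.flat ℚ_[p] (nonZeroDivisors ℤ_[p])
  let ι : N →ₗ[ℤ_[p]] C := N.subtype.restrictScalars ℤ_[p]
  have hbij := Module.bijective_baseChange_of_pow_smul ℚ_[p] (isUnit_algebraMap_p p) ι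
    (fun x hx => ⟨0, by
      rw [pow_zero, one_smul]
      exact Subtype.ext hx⟩)
    (fun y => ⟨k, ⟨ψ y, LinearMap.mem_range_self ψ y⟩, by
      rw [algebraMap_p_pow_smul p k y]
      rfl⟩)
  exact Module.Finite.equiv (LinearEquiv.ofBijective _ hbij)

end FiniteBaseChange

/-! ## §2 `E/sE` is `ℤ_p`-free of rank `rank_A E` when `A/(s) = ℤ_p` -/

section QuotientFree

variable (p : ℕ) [Fact p.Prime]
variable {A : Type u} [CommRing A] [Algebra ℤ_[p] A]

/-- If `π₀ : A → ℤ_p` is a retraction of the structure map with kernel `(s)` (so `A/(s) = ℤ_p`), and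
`E` is `A`-free with basis indexed by `Fin n`, then `E / sE ≅ ℤ_p^n` as `ℤ_p`-modules (coordinates
followed by `π₀`). [folklore] -/
theorem nonempty_quotient_smul_linearEquiv (π₀ : A →+* ℤ_[p])
    (hπ₀ : ∀ z : ℤ_[p], π₀ (algebraMap ℤ_[p] A z) = z) (s : A) (hker : ∀ a : A, π₀ a = 0 ↔ s ∣ a)
    {E : Type*} [AddCommGroup E] [Module A E] [Module ℤ_[p] E] [IsScalarTower ℤ_[p] A E]
    {n : ℕ} (b : Module.Basis (Fin n) A E) :
    Nonempty ((E ⧸ LinearMap.range ((LinearMap.lsmul A E s).restrictScalars ℤ_[p])) ≃ₗ[ℤ_[p]]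
      (Fin n → ℤ_[p])) := by
  -- `π₀` as a `ℤ_p`-linear map
  let π₀ℓ : A →ₗ[ℤ_[p]] ℤ_[p] :=
    { toFun := π₀
      map_add' := fun x y => map_add π₀ x y
      map_smul' := fun z a => by
        rw [Algebra.smul_def, map_mul, hπ₀, RingHom.id_apply, smul_eq_mul] }
  -- coordinates mod `s`
  let Ψ : E →ₗ[ℤ_[p]] (Fin n → ℤ_[p]) :=
    (π₀ℓ.compLeft (Fin n)).comp (b.equivFun.toLinearMap.restrictScalars ℤ_[p])
  have hΨ : ∀ e i, Ψ e i = π₀ (b.repr e i) := fun e i => rfl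
  have hΨsurj : Function.Surjective Ψ := by
    intro v
    refine ⟨∑ i, algebraMap ℤ_[p] A (v i) • b i, funext fun i => ?_⟩
    rw [hΨ, b.repr_sum_self, hπ₀]
  have hΨker : LinearMap.ker Ψ = LinearMap.range ((LinearMap.lsmul A E s).restrictScalars ℤ_[p]) := by
    ext e
    rw [LinearMap.mem_ker, LinearMap.mem_range]
    constructor
    · intro he
      have hdiv : ∀ i, s ∣ b.repr e i := fun i => (hker _).1 (by rw [← hΨ, he]; rfl)
      choose c hc using hdiv
      refine ⟨∑ i, c i • b i, ?_⟩
      rw [LinearMap.restrictScalars_apply, LinearMap.lsmul_apply, Finset.smul_sum, ← b.sum_repr e]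
      refine Finset.sum_congr rfl fun i _ => ?_
      rw [smul_smul, ← hc]
    · rintro ⟨e', rfl⟩
      funext i
      rw [hΨ, LinearMap.restrictScalars_apply, LinearMap.lsmul_apply, map_smul, Finsupp.smul_apply,
        smul_eq_mul, map_mul, (hker s).2 (dvd_refl s), zero_mul]
      rfl
  exact ⟨(Submodule.quotEquivOfEq _ _ hΨker.symm).trans (LinearMap.quotKerEquivOfSurjective Ψ hΨsurj)⟩

end QuotientFree

end Summit.BirchSwinnertonDyer.BirchSwinnertonDyer.Theorems.IwasawaTwoVariable

end
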